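import Summits.BirchSwinnertonDyer.BirchSwinnertonDyer.Theorems.ClassRecordThreeShimuraKolyvaginOrderBoundAtThreeSurjHOfNamed
import HarnessLib

/-!
# Crux `ShimuraKolyvaginOrderBoundAtThreeSurj` (item stmt-BirchSwinnertonDyer-19899) — the SPLIT-GENERIC Shimura
# CM-point PRIMITIVES `π₃ˢ` (every odd `p` split in `K` with `E[p]` irreducible; no `Surj`, no `p ∣ N`, no `p = 3`)
# imply the `p = 3` PRIMITIVES `π₃`, and stub H from NAMED inputs + `π₃ˢ`

Cell `bsd-stepL` (run/shared/lean/pub/bsd-stepL/), seat `bsd-stepL-shim3a` (prover g4), HELPER for the shared crux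
(`--supports stmt-BirchSwinnertonDyer-19899 --as helper`; K2@3 `route-BirchSwinnertonDyer-ClassRecordThree` + KOLY
`route-BirchSwinnertonDyer-KolyvaginRoadThree`; skeleton v3 b5621f5fb3bef0cc). Summit-side THEOREMS ONLY (no definition,
no named fact, no `sorry`); Theses-free (the Theses-importing closers are the sequel `…SurjOfSplitPrimitives.lean`).

## What and why

g3's canonical PRIMITIVES supplier `π₃` (binder `hPrim` of `…SurjHOfPrimitives` p496956 ∕ `…SurjHOfNamed` p499393 ∕
`…SurjOfNamed` p499945) carries the crux's OWN binders `Rank1Residual.Surj W 3 →`, `p ∣ N →`, `p = 3 →` in front of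
a conclusion — the CM-point family on `X_{N⁺,N⁻}` with the Cai–Shu–Tian display (B1), `ε = ±1`, and the labels
(B2) (B3) (B3₀) (B4) (B5) — whose printed sources do not mention `p` at all except in the degree-valuation clause
`ord_p degy = ord_p P₀.deg` (JSW 2017 Rem. 18 ∕ Pasten 2023 Prop. 5.1: an `(ℓ₀-good)` prime exists as soon as `E[p]` is
irreducible). The route's HELD printed support `ShimuraHeegnerPointGrossZagierPrinted` (item 19381, K2@3 + KOLY) is
exactly clause (B1) + the degree clause at EVERY odd `p` split in `K` with `E[p]` irreducible. So the natural aside is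
**`π₃ˢ` := 19381's binders VERBATIM (`W.conductorNorm ℤ = N → p ≠ 2 → Irr → … → p split → P₀.IsMinimalFor W`) followed by
`π₃`'s `∃`-body VERBATIM** — one text that yields `π₃` (this file, §1: discard the three idle binders) AND item 19381
(sequel `ClassRecordThreeShimuraHeegnerPointGrossZagierPrintedOfSplitPrimitives.lean`: project to (B1)). If the planner
holds `π₃ˢ` as the Shimura aside of the 19899 DOWN (plan g30 RULING 5), then BOTH the restated crux `…SurjR` AND the
HELD support 19381 are derived from it by name — one HELD printed input fewer in each @3 cone, exactly as shim-p1's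
p502508 retires 19717 on K2. §2 is stub H (registered signature VERBATIM) from {PT, GZK, modularity, CT₃, `π₃ˢ`}.

HONEST FRAMING: CONDITIONAL on the binders — `π₃ˢ` is construction-grade (the tree has no CM points on `X_{N⁺,N⁻}`),
`casselsTate_levelInputs`, Poitou–Tate, GZK, modularity are named print, none discharged here; item 19899 stays OPEN as
registered; BSD is not proved; no census number moves (T7). `π₃ˢ` asserts MORE than `π₃` (every odd split `p` with
`E[p]` irreducible, `p ∣ N` or not) — and exactly as much as 19381 ∧ (the `p`-free family clauses of `π₃`).
[cite: CaiShuTian2014, Thm. 1.5 and special case 1] [cite: JetchevSkinnerWan2017, §4.3, Rem. 17, Rem. 18, Thm. 4.4.1]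
[cite: PastenShimura2024, §2 p. 12, Prop. 5.1] [cite: GrossLMS1991, §3 Prop. 3.7, §4 (4.1), §5 Prop. 5.3]
[cite: BertoliniDarmon1996, §2.4–2.5, Prop. 2.6] [cite: Nekovar2007, (4.8), (4.9), Thm. 3.2]
[cite: McCallumLMS1991, §1 Theorem (Kolyvagin)] [cite: MilneADT2006, Ch. I §6 Thm. 6.13(a)]
presearch: `lean search 'splitPrimitives|SplitPrimitives'` → none; corpus ∕ galaxy as p496956 (CST Thm 1.5 is stated for
every prime-to-`NDc` test vector, no `p`; BD96 §2 and Gross §3 are `p`-free) — [corpus:paper:arxiv-1408.1733 p. 6–7],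
[corpus:book:editornd-l-functions-arithmetic chunks 215–220].
-/

noncomputable section

open scoped Classical AddSubgroup
set_option linter.dupNamespace false
namespace Summit.BirchSwinnertonDyer.BirchSwinnertonDyer.Theorems.ShimuraKolyvaginSurjHOfSplitPrimitives

open WeierstrassCurve NumberField IsDedekindDomain Field Function CongruenceSubgroup
  Literature.NumberTheory.Automorphic Literature.NumberTheory.EllipticCurves.ModularForms
  Literature.NumberTheory.EllipticCurves Literature.NumberTheory.EllipticCurves.KolyvaginCocycle
  Literature.NumberTheory.EllipticCurves.KolyvaginEuler
  Literature.NumberTheory.EllipticCurves.KolyvaginDescent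
  Literature.NumberTheory.EllipticCurves.RingClassField
  Literature.NumberTheory.GaloisRepresentations Literature.NumberTheory.GaloisCohomology
  Literature.NumberTheory.NumberFields Literature.NumberTheory.DiophantineGeometry
  Summit.BirchSwinnertonDyer.Rank1Residual.X11b
  Summit.BirchSwinnertonDyer.BirchSwinnertonDyer.Theorems
  Summit.BirchSwinnertonDyer.BirchSwinnertonDyer.Theorems.ShimuraKolyvaginSurjHOfPrimitives
  Summit.BirchSwinnertonDyer.BirchSwinnertonDyer.Theorems.ShimuraKolyvaginSurjHOfNamed
open Literature.NumberTheory.GaloisRepresentations.DiscreteGaloisModule (mu MuCarrier)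

/-- **`π₃ˢ ⟹ π₃`**: the `p = 3` PRIMITIVES supplier of p496956 ∕ p499393 ∕ p499945 (binder `hPrim`, VERBATIM) from the
split-generic one — the binders `Surj W 3`, `p ∣ N`, `p = 3` of `π₃` are simply not used. [cite: CaiShuTian2014, Thm. 1.5]
[cite: GrossLMS1991, §3 Prop. 3.7, §5 Prop. 5.3] [cite: BertoliniDarmon1996, Prop. 2.6] -/
theorem shimuraPrimitives_of_splitPrimitives
    (hPrimS : ∀ (W : WeierstrassCurve ℚ) [W.IsElliptic] [W.IsGloballyMinimal] (p : ℕ) [Fact p.Prime]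
      (N : ℕ) [NeZero N] (K : Type) [Field K] [NumberField K] (S : Finset ℕ)
      (Dt : ModularParametrizationData W N)
      (X : ShimuraCurveData (∏ q ∈ S, q) (N / ∏ q ∈ S, q))
      (W' : WeierstrassCurve ℚ) [W'.IsElliptic] (P₀ : ShimuraParametrizationData X W'),
      W.conductorNorm ℤ = N →
      p ≠ 2 → W.HasIrreducibleModPGaloisRep p →
      IsImaginaryQuadratic K → Even S.card →
      (∀ ℓ ∈ S, ℓ.Prime ∧ ℓ ∣ N ∧ ¬ ℓ ^ 2 ∣ N ∧
        ((Ideal.span {(ℓ : ℤ)}).primesOver (𝓞 K)).ncard = 1 ∧ ¬ (ℓ : ℤ) ∣ NumberField.discr K) →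
      (∀ ℓ : ℕ, ℓ.Prime → ℓ ∣ N → ℓ ∉ S → ((Ideal.span {(ℓ : ℤ)}).primesOver (𝓞 K)).ncard = 2) →
      ((Ideal.span {(p : ℤ)}).primesOver (𝓞 K)).ncard = 2 →
      P₀.IsMinimalFor W →
      ∃ (ι : K →+* ℂ) (y : (m : ℕ) → (W.baseChange (ringClassField K ι m)).toAffine.Point)
        (yK : (W.baseChange K).toAffine.Point) (ε : ℤ) (degy : ℕ), 0 < degy ∧
        padicValNat p degy = padicValNat p P₀.deg ∧
        LDerivEK W K =
            8 * (Real.pi : ℂ) ^ 2 * peterssonProduct (Gamma0 N) 2 Dt.f Dt.f /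
                ((((Units.torsionOrder K : ℝ) / 2) ^ 2 * √|(NumberField.discr K : ℝ)| : ℝ) : ℂ) *
              ((yK.canonicalHeight : ℂ) / (degy : ℂ)) ∧
        (ε = 1 ∨ ε = -1) ∧
        (∀ T : Finset (ringClassField K ι 1 ≃ₐ[ℚ] ringClassField K ι 1),
          (∀ g, g ∈ T ↔ g ∈ ringClassGal ι 1) →
          WeierstrassCurve.Affine.Point.map (W' := W)
              (algebraMap K (ringClassField K ι 1)).toRatAlgHom yK =
            ∑ g ∈ T, pointGalHom W (ringClassField K ι 1) g (y 1)) ∧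
        (∀ (m : ℕ), m ≠ 0 → ∀ τm : ringClassField K ι m ≃ₐ[ℚ] ringClassField K ι m,
          (∀ x : ringClassField K ι m, ((τm x : ringClassField K ι m) : ℂ) = starRingEnd ℂ x) →
          ∃ σ' ∈ ringClassGal ι m, IsOfFinAddOrder
            (pointGalHom W (ringClassField K ι m) τm (y m) -
              ε • pointGalHom W (ringClassField K ι m) σ' (y m))) ∧
        (∀ c : K ≃ₐ[ℚ] K, c ≠ 1 →
          IsOfFinAddOrder (WeierstrassCurve.Affine.Point.map (W' := W) (c : K →ₐ[ℚ] K) yK - ε • yK)) ∧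
        (∀ m : ℕ, Squarefree m →
          (∀ q ∈ m.primeFactors, ¬ q ∣ N ∧ (Ideal.span {(q : 𝓞 K)}).IsPrime) →
          ∀ (ℓ : ℕ) (_ : ℓ ∈ m.primeFactors) (hle : ringClassField K ι (m / ℓ) ≤ ringClassField K ι m)
            (σ : ringClassField K ι m ≃ₐ[ℚ] ringClassField K ι m),
            Subgroup.zpowers σ = ringClassGalOver ι m (m / ℓ) →
            letI : Algebra K ℂ := ι.toAlgebra
            ∑ i ∈ Finset.range (ℓ + 1), pointGalHom W (ringClassField K ι m) (σ ^ i) (y m) =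
              W.frobeniusTrace ℓ • WeierstrassCurve.Affine.Point.map (W' := W)
                ((RingClassField.inclusion ι hle).restrictScalars ℚ) (y (m / ℓ))) ∧
        (∀ m : ℕ, Squarefree m →
          (∀ q ∈ m.primeFactors, ¬ q ∣ N ∧ (Ideal.span {(q : 𝓞 K)}).IsPrime) →
          ∀ (ℓ : ℕ) (_ : ℓ ∈ m.primeFactors) [Fact ℓ.Prime] (hΔ : ¬ (ℓ : ℤ) ∣ minimalDiscriminantInt W)
            (φ₀ : absoluteGaloisGroup (ZMod ℓ)), (∀ x : AlgebraicClosure (ZMod ℓ), φ₀ • x = x ^ ℓ) →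
          ∀ (hle : ringClassField K ι (m / ℓ) ≤ ringClassField K ι m)
            (emb : ringClassField K ι m →+* AlgebraicClosure K),
            (∀ x : K, emb (algebraMap K (ringClassField K ι m) x) = algebraMap K (AlgebraicClosure K) x) →
          ∀ (j : (W.baseChange (ringClassField K ι m)).toAffine.Point →+ geomPoints (W.baseChange K)),
            j = WeierstrassCurve.Affine.Point.map (W' := W) emb.toRatAlgHom →
          ∀ γ : ringClassField K ι m ≃ₐ[ℚ] ringClassField K ι m, γ ∈ ringClassGal ι m →
            letI : Algebra K ℂ := ι.toAlgebra
            geomReduction hΔ ((RatClosure.pointsEquiv (K := K) W).symm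
                (j (pointGalHom W (ringClassField K ι m) γ (y m)))) =
              φ₀ • geomReduction hΔ ((RatClosure.pointsEquiv (K := K) W).symm
                (j (pointGalHom W (ringClassField K ι m) γ
                  (WeierstrassCurve.Affine.Point.map (W' := W)
                    ((RingClassField.inclusion ι hle).restrictScalars ℚ) (y (m / ℓ)))))))) :
  ∀ (W : WeierstrassCurve ℚ) [W.IsElliptic] [W.IsGloballyMinimal] (p : ℕ) [Fact p.Prime]
    (N : ℕ) [NeZero N] (K : Type) [Field K] [NumberField K] (S : Finset ℕ)
    (Dt : ModularParametrizationData W N)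
    (X : ShimuraCurveData (∏ q ∈ S, q) (N / ∏ q ∈ S, q))
    (W' : WeierstrassCurve ℚ) [W'.IsElliptic] (P₀ : ShimuraParametrizationData X W'),
    W.conductorNorm ℤ = N → Literature.NumberTheory.EllipticCurves.Rank1Residual.Surj W 3 →
    p ≠ 2 → W.HasIrreducibleModPGaloisRep p →
    IsImaginaryQuadratic K → Even S.card →
    (∀ ℓ ∈ S, ℓ.Prime ∧ ℓ ∣ N ∧ ¬ ℓ ^ 2 ∣ N ∧
      ((Ideal.span {(ℓ : ℤ)}).primesOver (𝓞 K)).ncard = 1 ∧ ¬ (ℓ : ℤ) ∣ NumberField.discr K) →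
    (∀ ℓ : ℕ, ℓ.Prime → ℓ ∣ N → ℓ ∉ S → ((Ideal.span {(ℓ : ℤ)}).primesOver (𝓞 K)).ncard = 2) →
    ((Ideal.span {(p : ℤ)}).primesOver (𝓞 K)).ncard = 2 →
    P₀.IsMinimalFor W →
    p ∣ N → p = 3 →
    ∃ (ι : K →+* ℂ) (y : (m : ℕ) → (W.baseChange (ringClassField K ι m)).toAffine.Point)
      (yK : (W.baseChange K).toAffine.Point) (ε : ℤ) (degy : ℕ), 0 < degy ∧
      padicValNat p degy = padicValNat p P₀.deg ∧
      LDerivEK W K =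
          8 * (Real.pi : ℂ) ^ 2 * peterssonProduct (Gamma0 N) 2 Dt.f Dt.f /
              ((((Units.torsionOrder K : ℝ) / 2) ^ 2 * √|(NumberField.discr K : ℝ)| : ℝ) : ℂ) *
            ((yK.canonicalHeight : ℂ) / (degy : ℂ)) ∧
      (ε = 1 ∨ ε = -1) ∧
      (∀ T : Finset (ringClassField K ι 1 ≃ₐ[ℚ] ringClassField K ι 1),
        (∀ g, g ∈ T ↔ g ∈ ringClassGal ι 1) →
        WeierstrassCurve.Affine.Point.map (W' := W)
            (algebraMap K (ringClassField K ι 1)).toRatAlgHom yK =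
          ∑ g ∈ T, pointGalHom W (ringClassField K ι 1) g (y 1)) ∧
      (∀ (m : ℕ), m ≠ 0 → ∀ τm : ringClassField K ι m ≃ₐ[ℚ] ringClassField K ι m,
        (∀ x : ringClassField K ι m, ((τm x : ringClassField K ι m) : ℂ) = starRingEnd ℂ x) →
        ∃ σ' ∈ ringClassGal ι m, IsOfFinAddOrder
          (pointGalHom W (ringClassField K ι m) τm (y m) -
            ε • pointGalHom W (ringClassField K ι m) σ' (y m))) ∧
      (∀ c : K ≃ₐ[ℚ] K, c ≠ 1 →
        IsOfFinAddOrder (WeierstrassCurve.Affine.Point.map (W' := W) (c : K →ₐ[ℚ] K) yK - ε • yK)) ∧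
      (∀ m : ℕ, Squarefree m →
        (∀ q ∈ m.primeFactors, ¬ q ∣ N ∧ (Ideal.span {(q : 𝓞 K)}).IsPrime) →
        ∀ (ℓ : ℕ) (_ : ℓ ∈ m.primeFactors) (hle : ringClassField K ι (m / ℓ) ≤ ringClassField K ι m)
          (σ : ringClassField K ι m ≃ₐ[ℚ] ringClassField K ι m),
          Subgroup.zpowers σ = ringClassGalOver ι m (m / ℓ) →
          letI : Algebra K ℂ := ι.toAlgebra
          ∑ i ∈ Finset.range (ℓ + 1), pointGalHom W (ringClassField K ι m) (σ ^ i) (y m) =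
            W.frobeniusTrace ℓ • WeierstrassCurve.Affine.Point.map (W' := W)
              ((RingClassField.inclusion ι hle).restrictScalars ℚ) (y (m / ℓ))) ∧
      (∀ m : ℕ, Squarefree m →
        (∀ q ∈ m.primeFactors, ¬ q ∣ N ∧ (Ideal.span {(q : 𝓞 K)}).IsPrime) →
        ∀ (ℓ : ℕ) (_ : ℓ ∈ m.primeFactors) [Fact ℓ.Prime] (hΔ : ¬ (ℓ : ℤ) ∣ minimalDiscriminantInt W)
          (φ₀ : absoluteGaloisGroup (ZMod ℓ)), (∀ x : AlgebraicClosure (ZMod ℓ), φ₀ • x = x ^ ℓ) →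
        ∀ (hle : ringClassField K ι (m / ℓ) ≤ ringClassField K ι m)
          (emb : ringClassField K ι m →+* AlgebraicClosure K),
          (∀ x : K, emb (algebraMap K (ringClassField K ι m) x) = algebraMap K (AlgebraicClosure K) x) →
        ∀ (j : (W.baseChange (ringClassField K ι m)).toAffine.Point →+ geomPoints (W.baseChange K)),
          j = WeierstrassCurve.Affine.Point.map (W' := W) emb.toRatAlgHom →
        ∀ γ : ringClassField K ι m ≃ₐ[ℚ] ringClassField K ι m, γ ∈ ringClassGal ι m →
          letI : Algebra K ℂ := ι.toAlgebra
          geomReduction hΔ ((RatClosure.pointsEquiv (K := K) W).symm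
              (j (pointGalHom W (ringClassField K ι m) γ (y m)))) =
            φ₀ • geomReduction hΔ ((RatClosure.pointsEquiv (K := K) W).symm
              (j (pointGalHom W (ringClassField K ι m) γ
                (WeierstrassCurve.Affine.Point.map (W' := W)
                  ((RingClassField.inclusion ι hle).restrictScalars ℚ) (y (m / ℓ))))))) := by
  intro W _ _ p _ N _ K _ _ S Dt X W' _ P₀ hN _hsurj hp2 hirr hK hS hin hsp hps hmin _hpN _hp3
  exact hPrimS W p N K S Dt X W' P₀ hN hp2 hirr hK hS hin hsp hps hmin

/-- **Stub H `stub_orderBoundSurj_heegnerPointAtThree` (registered signature VERBATIM) from NAMED inputs — Poitou–Tate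
`hPT`, GZK over `ℚ` `hGZK`, modularity `hE`, the Literature fact `casselsTate_levelInputs` (every `K`) `hCTf` — and the
SPLIT-GENERIC PRIMITIVES `π₃ˢ`**: p499393 composed with §1. HONEST: conditional; H as registered stays OPEN.
[cite: McCallumLMS1991, §1 Theorem (Kolyvagin)] [cite: MilneADT2006, Ch. I §6 Thm. 6.13(a)] [cite: CaiShuTian2014, Thm. 1.5] -/
theorem stub_orderBoundSurj_heegnerPointAtThree_of_poitouTate_of_GZK_of_modularity_of_casselsTateLevelInputs_of_splitPrimitives
    (hPT : ∀ (K : Type) [Field K] [NumberField K], poitouTate_sum_localTatePairing_eq_zero K)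
    (hGZK : rank_eq_analyticRank_of_analyticRank_le_one) (hE : WeierstrassCurve.hasEntireLFunction_rat)
    (hCTf : ∀ (K : Type) [Field K] [NumberField K], casselsTate_levelInputs K)
    (hPrimS : ∀ (W : WeierstrassCurve ℚ) [W.IsElliptic] [W.IsGloballyMinimal] (p : ℕ) [Fact p.Prime]
      (N : ℕ) [NeZero N] (K : Type) [Field K] [NumberField K] (S : Finset ℕ)
      (Dt : ModularParametrizationData W N)
      (X : ShimuraCurveData (∏ q ∈ S, q) (N / ∏ q ∈ S, q))
      (W' : WeierstrassCurve ℚ) [W'.IsElliptic] (P₀ : ShimuraParametrizationData X W'),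
      W.conductorNorm ℤ = N →
      p ≠ 2 → W.HasIrreducibleModPGaloisRep p →
      IsImaginaryQuadratic K → Even S.card →
      (∀ ℓ ∈ S, ℓ.Prime ∧ ℓ ∣ N ∧ ¬ ℓ ^ 2 ∣ N ∧
        ((Ideal.span {(ℓ : ℤ)}).primesOver (𝓞 K)).ncard = 1 ∧ ¬ (ℓ : ℤ) ∣ NumberField.discr K) →
      (∀ ℓ : ℕ, ℓ.Prime → ℓ ∣ N → ℓ ∉ S → ((Ideal.span {(ℓ : ℤ)}).primesOver (𝓞 K)).ncard = 2) →
      ((Ideal.span {(p : ℤ)}).primesOver (𝓞 K)).ncard = 2 →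
      P₀.IsMinimalFor W →
      ∃ (ι : K →+* ℂ) (y : (m : ℕ) → (W.baseChange (ringClassField K ι m)).toAffine.Point)
        (yK : (W.baseChange K).toAffine.Point) (ε : ℤ) (degy : ℕ), 0 < degy ∧
        padicValNat p degy = padicValNat p P₀.deg ∧
        LDerivEK W K =
            8 * (Real.pi : ℂ) ^ 2 * peterssonProduct (Gamma0 N) 2 Dt.f Dt.f /
                ((((Units.torsionOrder K : ℝ) / 2) ^ 2 * √|(NumberField.discr K : ℝ)| : ℝ) : ℂ) *
              ((yK.canonicalHeight : ℂ) / (degy : ℂ)) ∧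
        (ε = 1 ∨ ε = -1) ∧
        (∀ T : Finset (ringClassField K ι 1 ≃ₐ[ℚ] ringClassField K ι 1),
          (∀ g, g ∈ T ↔ g ∈ ringClassGal ι 1) →
          WeierstrassCurve.Affine.Point.map (W' := W)
              (algebraMap K (ringClassField K ι 1)).toRatAlgHom yK =
            ∑ g ∈ T, pointGalHom W (ringClassField K ι 1) g (y 1)) ∧
        (∀ (m : ℕ), m ≠ 0 → ∀ τm : ringClassField K ι m ≃ₐ[ℚ] ringClassField K ι m,
          (∀ x : ringClassField K ι m, ((τm x : ringClassField K ι m) : ℂ) = starRingEnd ℂ x) →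
          ∃ σ' ∈ ringClassGal ι m, IsOfFinAddOrder
            (pointGalHom W (ringClassField K ι m) τm (y m) -
              ε • pointGalHom W (ringClassField K ι m) σ' (y m))) ∧
        (∀ c : K ≃ₐ[ℚ] K, c ≠ 1 →
          IsOfFinAddOrder (WeierstrassCurve.Affine.Point.map (W' := W) (c : K →ₐ[ℚ] K) yK - ε • yK)) ∧
        (∀ m : ℕ, Squarefree m →
          (∀ q ∈ m.primeFactors, ¬ q ∣ N ∧ (Ideal.span {(q : 𝓞 K)}).IsPrime) →
          ∀ (ℓ : ℕ) (_ : ℓ ∈ m.primeFactors) (hle : ringClassField K ι (m / ℓ) ≤ ringClassField K ι m)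
            (σ : ringClassField K ι m ≃ₐ[ℚ] ringClassField K ι m),
            Subgroup.zpowers σ = ringClassGalOver ι m (m / ℓ) →
            letI : Algebra K ℂ := ι.toAlgebra
            ∑ i ∈ Finset.range (ℓ + 1), pointGalHom W (ringClassField K ι m) (σ ^ i) (y m) =
              W.frobeniusTrace ℓ • WeierstrassCurve.Affine.Point.map (W' := W)
                ((RingClassField.inclusion ι hle).restrictScalars ℚ) (y (m / ℓ))) ∧
        (∀ m : ℕ, Squarefree m →
          (∀ q ∈ m.primeFactors, ¬ q ∣ N ∧ (Ideal.span {(q : 𝓞 K)}).IsPrime) →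
          ∀ (ℓ : ℕ) (_ : ℓ ∈ m.primeFactors) [Fact ℓ.Prime] (hΔ : ¬ (ℓ : ℤ) ∣ minimalDiscriminantInt W)
            (φ₀ : absoluteGaloisGroup (ZMod ℓ)), (∀ x : AlgebraicClosure (ZMod ℓ), φ₀ • x = x ^ ℓ) →
          ∀ (hle : ringClassField K ι (m / ℓ) ≤ ringClassField K ι m)
            (emb : ringClassField K ι m →+* AlgebraicClosure K),
            (∀ x : K, emb (algebraMap K (ringClassField K ι m) x) = algebraMap K (AlgebraicClosure K) x) →
          ∀ (j : (W.baseChange (ringClassField K ι m)).toAffine.Point →+ geomPoints (W.baseChange K)),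
            j = WeierstrassCurve.Affine.Point.map (W' := W) emb.toRatAlgHom →
          ∀ γ : ringClassField K ι m ≃ₐ[ℚ] ringClassField K ι m, γ ∈ ringClassGal ι m →
            letI : Algebra K ℂ := ι.toAlgebra
            geomReduction hΔ ((RatClosure.pointsEquiv (K := K) W).symm
                (j (pointGalHom W (ringClassField K ι m) γ (y m)))) =
              φ₀ • geomReduction hΔ ((RatClosure.pointsEquiv (K := K) W).symm
                (j (pointGalHom W (ringClassField K ι m) γ
                  (WeierstrassCurve.Affine.Point.map (W' := W)
                    ((RingClassField.inclusion ι hle).restrictScalars ℚ) (y (m / ℓ)))))))) :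
  ∀ (W : WeierstrassCurve ℚ) [W.IsElliptic] [W.IsGloballyMinimal] (p : ℕ) [Fact p.Prime]
    (N : ℕ) [NeZero N] (K : Type) [Field K] [NumberField K] (S : Finset ℕ)
    (Dt : ModularParametrizationData W N)
    (X : ShimuraCurveData (∏ q ∈ S, q) (N / ∏ q ∈ S, q))
    (W' : WeierstrassCurve ℚ) [W'.IsElliptic] (P₀ : ShimuraParametrizationData X W'),
    W.conductorNorm ℤ = N → Literature.NumberTheory.EllipticCurves.Rank1Residual.Surj W 3 →
    p ≠ 2 → W.HasIrreducibleModPGaloisRep p →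
    IsImaginaryQuadratic K → Even S.card →
    (∀ ℓ ∈ S, ℓ.Prime ∧ ℓ ∣ N ∧ ¬ ℓ ^ 2 ∣ N ∧
      ((Ideal.span {(ℓ : ℤ)}).primesOver (𝓞 K)).ncard = 1 ∧ ¬ (ℓ : ℤ) ∣ NumberField.discr K) →
    (∀ ℓ : ℕ, ℓ.Prime → ℓ ∣ N → ℓ ∉ S → ((Ideal.span {(ℓ : ℤ)}).primesOver (𝓞 K)).ncard = 2) →
    ((Ideal.span {(p : ℤ)}).primesOver (𝓞 K)).ncard = 2 →
    P₀.IsMinimalFor W →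
    p ∣ N → p = 3 →
    ∃ (P : (W.baseChange K).toAffine.Point) (degS : ℕ), 0 < degS ∧
      padicValNat p degS = padicValNat p P₀.deg ∧
      LDerivEK W K =
          8 * (Real.pi : ℂ) ^ 2 * peterssonProduct (Gamma0 N) 2 Dt.f Dt.f /
              ((((Units.torsionOrder K : ℝ) / 2) ^ 2 * √|(NumberField.discr K : ℝ)| : ℝ) : ℂ) *
            ((P.canonicalHeight : ℂ) / (degS : ℂ)) ∧
      (¬ IsOfFinAddOrder P →
        Nat.card (AddCommGroup.primaryComponent (W.baseChange K).sha p) ≤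
            p ^ (2 * padicValNat p (AddSubgroup.zmultiples P).index)) :=
  stub_orderBoundSurj_heegnerPointAtThree_of_poitouTate_of_GZK_of_modularity_of_casselsTateLevelInputs_of_shimuraPrimitives
    hPT hGZK hE hCTf (shimuraPrimitives_of_splitPrimitives hPrimS)

end Summit.BirchSwinnertonDyer.BirchSwinnertonDyer.Theorems.ShimuraKolyvaginSurjHOfSplitPrimitives

end
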